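import Summits.QuantumFields.BalabanUV.Beta.GAN24.CapacitanceClosedFormMatrix
import Summits.QuantumFields.BalabanUV.Beta.GAN24.AliasObjects

/-!
# `BalabanUV.Beta.GAN24.CapacitanceClosedFormAlias` — binder row G-an2-4 / (CONV-C), road P1-fibre, crux A4 of `SKELETON-P1.md` (typer row P1-Y08f, part 4):
# the TELESCOPING IDENTITIES for the concrete alias fibre of `GAN24/AliasObjects` and the explicit inverse of its capacitance matrix `cap N p`

NOT IN PRINT; OUR PROOF ATTEMPT.  HONEST FRAMING (cell contract, verbatim): «discharging `BetaPertH` makes Bałaban's UV stability UNCONDITIONAL — a real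
constructive-QFT result; it is NOT the continuum limit and NOT the Clay problem.»  HONEST DEPENDENCY (verbatim): «continuum YM on T⁴ ⇐ BetaPertH ∧ nine spine
estimates (0/9 proved); BetaPertH ⇐ (D1) ∧ (D4) ∧ CAP+tail; G-an2-4 gates asym, D1 and NE2/3/4.»  [folklore] geometric sums and finite-dimensional linear algebra
over `ℂ` (no estimate, no cited fact, no wall binder, no `def … : Prop` hypothesis).  NOT summit progress; nothing of (CONV-C)'s K-slot is discharged here.

## What is proved
For the alias objects of `GAN24/AliasObjects` (typer row P1-T00, p201364: fine momenta `kAl N p m = (p + 2π·repZ m)/N`, geometric sums `gs`, box weights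
`sAl/SAl` and their flat twins `sbAl/SbAl`, `chiAl = SbAl/N^D`, the alias fibre `fibreAl N p h : CapacitanceSolve.Fibre D (TorusSite D N)` with
`wQ = S·s`, `wM = S`, `wE = χ̂·s♭`, `wG = χ̂`, and the bordered matrix `cap N p`), for EVERY complex coarse momentum `p` and every `N ≥ 1`:
* `gs_mul_cexp_sub_one` (`Σ_{t<n} e^{izt} · (e^{iz} − 1) = e^{izn} − 1`), `cexp_I_kAl_mul` (`e^{i k_{m,κ} N} = e^{i p_κ}`: the alias label drops out),
  hence **`sAl_mul_dAl`** (`s_κ(m)·∂̂_κ(k_m) = ∂̂_κ(p)`) and **`dbAl_mul_sbAl`** (`∂̂♭_κ(k_m)·s♭_κ(m) = ∂̂♭_κ(p)`);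
* **`fibreAl_T1`**, **`fibreAl_T2`** — the telescoping identities (T1)/(T2) of `GAN24/CapacitanceClosedForm` for `fibreAl N p h` with `δ = dhat p`,
  `δ' = dflat p` (the COARSE-momentum symbols of `GAN24/FibreSymbols`);
* `cap_eq_capMat` (`AliasObjects.cap N p = Capacitance.capMat (fibreAl N p h)`), and therefore, under the three non-vanishings
  `aDiag (fibreAl N p h) κ ≠ 0`, `sigma (fibreAl N p h) ≠ 0`, `hSum (aDiag …) (dhat p) (dflat p) ≠ 0` (at real `p ∈ BZ ∖ {0}`: positivity, typer row P1-Y08s):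
  **`isUnit_cap`** / **`isUnit_cap_det`** — the binder `hdet : IsUnit (cap N p).det` of `AliasObjects.capSolves_closed`/`arrowSolves_closed` DISCHARGED
  without any determinant of the Bloch fibre matrix; **`cap_inv_eq`** (`(cap N p)⁻¹ = invMat (aDiag …) (dhat p) (dflat p) (sigma …)`);
  **`capSol_eq`**, `phiSol_eq`, `cSol_eq` — T00's `(cap N p)⁻¹ *ᵥ (r_φ; r_c)` IS the closed form `(phiCF; cCF)` of `CapacitanceClosedForm`;
* the scalars in T00 vocabulary: `aDiag_fibreAl` (`a_κ = Σ_m w_m·(s_κ(m)s♭_κ(m))/(2L_m)`), `sigma_fibreAl` (`σ = Σ_m w_m/L_m²`).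
-/

open Finset Complex
open scoped BigOperators Real

namespace Summit.QuantumFields.BalabanUV.Beta.GAN24.CapacitanceClosedFormAlias

open Literature.Probability.LatticeModels (TorusSite)
open Literature.MathematicalPhysics.QuantumFieldTheory.LatticeForm (repZ)
open FibreSymbols (dhat dflat lapSym)
open FibreBlockSolve (dot)
open CapacitanceClosedForm (hSum phiCF cCF aDiag sigma)
open CapacitanceClosedFormMatrix (invMat invMat_mulVec isUnit_capMat inv_capMat_eq)
open AliasObjects (kAl kAl_apply gs sAl SAl sbAl SbAl chiAl wAl dAl dbAl LAl fibreAl cap capSol phiSol cSol srcPhi srcC)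

variable {D : ℕ}

/-! ## §1 Geometric-sum telescoping -/

/-- [folklore] `gs z (n+1) = gs z n + e^{izn}`. -/
theorem gs_succ (z : ℂ) (n : ℕ) : gs z (n + 1) = gs z n + cexp (I * z * n) := by
  simp [gs, Finset.sum_range_succ]

/-- [folklore] **GEOMETRIC SUM × (RATIO − 1)**: `(Σ_{t<n} e^{izt})·(e^{iz} − 1) = e^{izn} − 1` (no division: valid also when `e^{iz} = 1`). -/
theorem gs_mul_cexp_sub_one (z : ℂ) (n : ℕ) : gs z n * (cexp (I * z) - 1) = cexp (I * z * n) - 1 := by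
  induction n with
  | zero => simp [gs]
  | succ n ih =>
    rw [gs_succ, add_mul, ih, Nat.cast_succ]
    have e : cexp (I * z * n) * cexp (I * z) = cexp (I * z * (n + 1)) := by
      rw [← Complex.exp_add]; congr 1; ring
    linear_combination e

/-- [folklore] **THE ALIAS LABEL DROPS OUT**: `e^{i k_{m,κ} N} = e^{i p_κ}` since `k_{m,κ} N = p_κ + 2π·repZ m κ`. -/
theorem cexp_I_kAl_mul (N : ℕ) [NeZero N] (p : Fin D → ℂ) (m : TorusSite D N) (κ : Fin D) :
    cexp (I * kAl N p m κ * N) = cexp (I * p κ) := by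
  have hN : (N : ℂ) ≠ 0 := Nat.cast_ne_zero.mpr (NeZero.ne N)
  rw [kAl_apply]
  have e : I * ((p κ + 2 * π * (repZ m κ : ℂ)) / (N : ℂ)) * N = I * p κ + (repZ m κ : ℂ) * (2 * π * I) := by
    rw [mul_assoc, div_mul_cancel₀ _ hN]; ring
  rw [e, Complex.exp_add, Complex.exp_int_mul_two_pi_mul_I, mul_one]

/-- [folklore] Flat version: `e^{−i k_{m,κ} N} = e^{−i p_κ}`. -/
theorem cexp_neg_I_kAl_mul (N : ℕ) [NeZero N] (p : Fin D → ℂ) (m : TorusSite D N) (κ : Fin D) :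
    cexp (I * (-kAl N p m κ) * N) = cexp (-(I * p κ)) := by
  rw [show I * (-kAl N p m κ) * N = -(I * kAl N p m κ * N) by ring, Complex.exp_neg, cexp_I_kAl_mul, ← Complex.exp_neg]

/-- [folklore] **`s_κ(m)·∂̂_κ(k_m) = ∂̂_κ(p)`** — the box weight times the fine symbol is the COARSE symbol, independently of the alias `m`. -/
theorem sAl_mul_dAl (N : ℕ) [NeZero N] (p : Fin D → ℂ) (m : TorusSite D N) (κ : Fin D) :
    sAl N p m κ * dAl N p m κ = dhat p κ := by
  show gs (kAl N p m κ) N * (cexp (I * kAl N p m κ) - 1) = cexp (I * p κ) - 1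
  rw [gs_mul_cexp_sub_one, cexp_I_kAl_mul]

/-- [folklore] **`∂̂♭_κ(k_m)·s♭_κ(m) = ∂̂♭_κ(p)`** — the flat twin. -/
theorem dbAl_mul_sbAl (N : ℕ) [NeZero N] (p : Fin D → ℂ) (m : TorusSite D N) (κ : Fin D) :
    dbAl N p m κ * sbAl N p m κ = dflat p κ := by
  show (cexp (-(I * kAl N p m κ)) - 1) * gs (-kAl N p m κ) N = cexp (-(I * p κ)) - 1
  rw [mul_comm, show -(I * kAl N p m κ) = I * (-kAl N p m κ) by ring, gs_mul_cexp_sub_one, cexp_neg_I_kAl_mul]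

/-! ## §2 The telescoping identities (T1)/(T2) for the alias fibre -/

/-- [folklore] **(T1)** for `fibreAl`: `wQ m κ · ∂_{mκ} = wM m · ∂̂_κ(p)`. -/
theorem fibreAl_T1 (N : ℕ) [NeZero N] (p : Fin D → ℂ) (h : ∀ m, LAl N p m ≠ 0) (m : TorusSite D N) (κ : Fin D) :
    (fibreAl N p h).wQ m κ * (fibreAl N p h).dd m κ = (fibreAl N p h).wM m * dhat p κ := by
  show SAl N p m * sAl N p m κ * dAl N p m κ = SAl N p m * dhat p κ
  rw [mul_assoc, sAl_mul_dAl]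

/-- [folklore] **(T2)** for `fibreAl`: `∂♭_{mκ} · wE m κ = wG m · ∂̂♭_κ(p)`. -/
theorem fibreAl_T2 (N : ℕ) [NeZero N] (p : Fin D → ℂ) (h : ∀ m, LAl N p m ≠ 0) (m : TorusSite D N) (κ : Fin D) :
    (fibreAl N p h).db m κ * (fibreAl N p h).wE m κ = (fibreAl N p h).wG m * dflat p κ := by
  show dbAl N p m κ * (chiAl N p m * sbAl N p m κ) = chiAl N p m * dflat p κ
  rw [mul_left_comm, dbAl_mul_sbAl]

/-- [folklore] The diagonal scalar in T00 vocabulary: `a_κ = Σ_m w_m·(s_κ(m)·s♭_κ(m))/(2L_m)`. -/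
theorem aDiag_fibreAl (N : ℕ) [NeZero N] (p : Fin D → ℂ) (h : ∀ m, LAl N p m ≠ 0) (κ : Fin D) :
    aDiag (fibreAl N p h) κ = ∑ m, wAl N p m * (sAl N p m κ * sbAl N p m κ) / (2 * LAl N p m) := by
  unfold aDiag
  refine Finset.sum_congr rfl fun m _ => ?_
  show SAl N p m * sAl N p m κ * (chiAl N p m * sbAl N p m κ) / (2 * LAl N p m) = _
  rw [wAl]
  ring

/-- [folklore] The border scalar in T00 vocabulary: `σ = Σ_m w_m/L_m²`. -/
theorem sigma_fibreAl (N : ℕ) [NeZero N] (p : Fin D → ℂ) (h : ∀ m, LAl N p m ≠ 0) :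
    sigma (fibreAl N p h) = ∑ m, wAl N p m / LAl N p m ^ 2 := by
  unfold sigma
  exact Finset.sum_congr rfl fun m _ => rfl

/-! ## §3 The concrete capacitance matrix and its explicit inverse -/

/-- [folklore] T00's bordered matrix IS leaf-15/leaf-06's abstract capacitance matrix of the alias fibre. -/
theorem cap_eq_capMat (N : ℕ) [NeZero N] (p : Fin D → ℂ) (h : ∀ m, LAl N p m ≠ 0) :
    cap N p = Capacitance.capMat (fibreAl N p h) := by
  ext i j
  rcases i with κ | u <;> rcases j with l | u'
  · rw [AliasObjects.cap_inl_inl, Capacitance.capMat, Matrix.fromBlocks_apply₁₁, Matrix.of_apply, AliasObjects.capP_eq N p h]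
  · rw [AliasObjects.cap_inl_inr, Capacitance.capMat, Matrix.fromBlocks_apply₁₂, Matrix.of_apply, AliasObjects.capV_eq N p h]
  · rw [AliasObjects.cap_inr_inl, Capacitance.capMat, Matrix.fromBlocks_apply₂₁, Matrix.of_apply, AliasObjects.capW_eq N p h]
  · rw [AliasObjects.cap_inr_inr, Capacitance.capMat, Matrix.fromBlocks_apply₂₂, Matrix.zero_apply]

/-- [folklore] **`cap N p` IS A UNIT** under (the automatic) (T1)/(T2) and the three non-vanishings — no determinant of the fibre matrix needed. -/
theorem isUnit_cap (N : ℕ) [NeZero N] (p : Fin D → ℂ) (h : ∀ m, LAl N p m ≠ 0) (ha : ∀ κ, aDiag (fibreAl N p h) κ ≠ 0)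
    (hσ : sigma (fibreAl N p h) ≠ 0) (hh : hSum (aDiag (fibreAl N p h)) (dhat p) (dflat p) ≠ 0) : IsUnit (cap N p) := by
  rw [cap_eq_capMat N p h]
  exact isUnit_capMat (fibreAl N p h) (dhat p) (dflat p) (fibreAl_T1 N p h) (fibreAl_T2 N p h) ha hσ hh

/-- [folklore] **THE `hdet` BINDER OF `AliasObjects.capSolves_closed` / `arrowSolves_closed`, DISCHARGED**: `IsUnit (cap N p).det`. -/
theorem isUnit_cap_det (N : ℕ) [NeZero N] (p : Fin D → ℂ) (h : ∀ m, LAl N p m ≠ 0) (ha : ∀ κ, aDiag (fibreAl N p h) κ ≠ 0)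
    (hσ : sigma (fibreAl N p h) ≠ 0) (hh : hSum (aDiag (fibreAl N p h)) (dhat p) (dflat p) ≠ 0) : IsUnit (cap N p).det :=
  (Matrix.isUnit_iff_isUnit_det _).mp (isUnit_cap N p h ha hσ hh)

/-- [folklore] **THE EXPLICIT INVERSE of `cap N p`.** -/
theorem cap_inv_eq (N : ℕ) [NeZero N] (p : Fin D → ℂ) (h : ∀ m, LAl N p m ≠ 0) (ha : ∀ κ, aDiag (fibreAl N p h) κ ≠ 0)
    (hσ : sigma (fibreAl N p h) ≠ 0) (hh : hSum (aDiag (fibreAl N p h)) (dhat p) (dflat p) ≠ 0) :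
    (cap N p)⁻¹ = invMat (aDiag (fibreAl N p h)) (dhat p) (dflat p) (sigma (fibreAl N p h)) := by
  rw [cap_eq_capMat N p h]
  exact inv_capMat_eq (fibreAl N p h) (dhat p) (dflat p) (fibreAl_T1 N p h) (fibreAl_T2 N p h) ha hσ hh

/-- [folklore] **T00's `capSol = (cap N p)⁻¹ *ᵥ (r_φ; r_c)` IS THE CLOSED FORM `(phiCF; cCF)`.** -/
theorem capSol_eq (N : ℕ) [NeZero N] (p : Fin D → ℂ) (h : ∀ m, LAl N p m ≠ 0) (ha : ∀ κ, aDiag (fibreAl N p h) κ ≠ 0)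
    (hσ : sigma (fibreAl N p h) ≠ 0) (hh : hSum (aDiag (fibreAl N p h)) (dhat p) (dflat p) ≠ 0)
    (fhat : TorusSite D N → Fin D → ℂ) (chat : Fin D → ℂ) :
    capSol N p fhat chat =
      Sum.elim (phiCF (aDiag (fibreAl N p h)) (dhat p) (dflat p) (sigma (fibreAl N p h)) (srcPhi N p fhat chat) (srcC N p fhat))
        (fun _ => cCF (aDiag (fibreAl N p h)) (dhat p) (dflat p) (sigma (fibreAl N p h)) (srcPhi N p fhat chat) (srcC N p fhat)) := by
  unfold capSol
  rw [cap_inv_eq N p h ha hσ hh, invMat_mulVec]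

/-- [folklore] The constraint multipliers, explicitly: `phiSol = phiCF …`. -/
theorem phiSol_eq (N : ℕ) [NeZero N] (p : Fin D → ℂ) (h : ∀ m, LAl N p m ≠ 0) (ha : ∀ κ, aDiag (fibreAl N p h) κ ≠ 0)
    (hσ : sigma (fibreAl N p h) ≠ 0) (hh : hSum (aDiag (fibreAl N p h)) (dhat p) (dflat p) ≠ 0)
    (fhat : TorusSite D N → Fin D → ℂ) (chat : Fin D → ℂ) :
    phiSol N p fhat chat = phiCF (aDiag (fibreAl N p h)) (dhat p) (dflat p) (sigma (fibreAl N p h)) (srcPhi N p fhat chat) (srcC N p fhat) := by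
  funext κ
  show capSol N p fhat chat (Sum.inl κ) = _
  rw [capSol_eq N p h ha hσ hh, Sum.elim_inl]

/-- [folklore] The block gauge constant, explicitly: `cSol = cCF …`. -/
theorem cSol_eq (N : ℕ) [NeZero N] (p : Fin D → ℂ) (h : ∀ m, LAl N p m ≠ 0) (ha : ∀ κ, aDiag (fibreAl N p h) κ ≠ 0)
    (hσ : sigma (fibreAl N p h) ≠ 0) (hh : hSum (aDiag (fibreAl N p h)) (dhat p) (dflat p) ≠ 0)
    (fhat : TorusSite D N → Fin D → ℂ) (chat : Fin D → ℂ) :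
    cSol N p fhat chat = cCF (aDiag (fibreAl N p h)) (dhat p) (dflat p) (sigma (fibreAl N p h)) (srcPhi N p fhat chat) (srcC N p fhat) := by
  show capSol N p fhat chat (Sum.inr ()) = _
  rw [capSol_eq N p h ha hσ hh, Sum.elim_inr]

/-- [folklore] Entries of `(cap N p)⁻¹`, `φφ` block: `= invPP (aDiag …) (dhat p) (dflat p) κ l` — so `CapacitanceClosedForm.norm_invPP_le` applies verbatim. -/
theorem cap_inv_inl_inl (N : ℕ) [NeZero N] (p : Fin D → ℂ) (h : ∀ m, LAl N p m ≠ 0) (ha : ∀ κ, aDiag (fibreAl N p h) κ ≠ 0)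
    (hσ : sigma (fibreAl N p h) ≠ 0) (hh : hSum (aDiag (fibreAl N p h)) (dhat p) (dflat p) ≠ 0) (κ l : Fin D) :
    (cap N p)⁻¹ (Sum.inl κ) (Sum.inl l) = CapacitanceClosedForm.invPP (aDiag (fibreAl N p h)) (dhat p) (dflat p) κ l := by
  rw [cap_inv_eq N p h ha hσ hh, CapacitanceClosedFormMatrix.invMat_inl_inl]

/-- [folklore] Entries of `(cap N p)⁻¹`, `φc` column. -/
theorem cap_inv_inl_inr (N : ℕ) [NeZero N] (p : Fin D → ℂ) (h : ∀ m, LAl N p m ≠ 0) (ha : ∀ κ, aDiag (fibreAl N p h) κ ≠ 0)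
    (hσ : sigma (fibreAl N p h) ≠ 0) (hh : hSum (aDiag (fibreAl N p h)) (dhat p) (dflat p) ≠ 0) (κ : Fin D) (u : Unit) :
    (cap N p)⁻¹ (Sum.inl κ) (Sum.inr u) = CapacitanceClosedForm.invPc (aDiag (fibreAl N p h)) (dhat p) (dflat p) (sigma (fibreAl N p h)) κ := by
  rw [cap_inv_eq N p h ha hσ hh, CapacitanceClosedFormMatrix.invMat_inl_inr]

/-- [folklore] Entries of `(cap N p)⁻¹`, `cφ` row. -/
theorem cap_inv_inr_inl (N : ℕ) [NeZero N] (p : Fin D → ℂ) (h : ∀ m, LAl N p m ≠ 0) (ha : ∀ κ, aDiag (fibreAl N p h) κ ≠ 0)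
    (hσ : sigma (fibreAl N p h) ≠ 0) (hh : hSum (aDiag (fibreAl N p h)) (dhat p) (dflat p) ≠ 0) (u : Unit) (l : Fin D) :
    (cap N p)⁻¹ (Sum.inr u) (Sum.inl l) = CapacitanceClosedForm.invcP (aDiag (fibreAl N p h)) (dhat p) (dflat p) (sigma (fibreAl N p h)) l := by
  rw [cap_inv_eq N p h ha hσ hh, CapacitanceClosedFormMatrix.invMat_inr_inl]

/-- [folklore] Entries of `(cap N p)⁻¹`, `cc` corner. -/
theorem cap_inv_inr_inr (N : ℕ) [NeZero N] (p : Fin D → ℂ) (h : ∀ m, LAl N p m ≠ 0) (ha : ∀ κ, aDiag (fibreAl N p h) κ ≠ 0)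
    (hσ : sigma (fibreAl N p h) ≠ 0) (hh : hSum (aDiag (fibreAl N p h)) (dhat p) (dflat p) ≠ 0) (u u' : Unit) :
    (cap N p)⁻¹ (Sum.inr u) (Sum.inr u') = CapacitanceClosedForm.invcc (aDiag (fibreAl N p h)) (dhat p) (dflat p) (sigma (fibreAl N p h)) := by
  rw [cap_inv_eq N p h ha hσ hh, CapacitanceClosedFormMatrix.invMat_inr_inr]

end Summit.QuantumFields.BalabanUV.Beta.GAN24.CapacitanceClosedFormAlias
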